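import Summits.HubbardSuperconductivity.HubbardSuperconductivity.Theorems.NodalWardXYDefs
import Literature.Probability.LatticeModels.RotatorGriffithsFirst

/-!
# `PerturbedXYOrder` (stmt-HubbardSuperconductivity-10739) — line `schwarz-inheritance`, stub `stub_twoPointNonneg`

Griffiths' first inequality for the torus plane rotator: `∫_{[0,2π]^Λ} cos(θ_x − θ_y) e^{J Σ_b cos ∇_b θ} dθ ≥ 0` for `J ≥ 0`.

The mathematics is the Literature theorem
`Literature.Probability.LatticeModels.setIntegral_torus_cos_mul_exp_nonneg`
(`Literature/Probability/LatticeModels/RotatorGriffithsFirst.lean`, landed for this stub):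
Griffiths' first inequality `0 ≤ ⟨cos(θ_x − θ_y)⟩_β` for the pure XY model on any finite bond
system in Haar form (from the tree's Messager–Miracle-Solé–Pfister inequality
`BondSystem.expect_cosDiff_le_expect_one` at the pure gauge `φ_y = −1`, whose two-point function
is `−⟨cos(θ_x − θ_y)⟩` by gauge covariance), transported to the closed angle cube `[0, 2π]^Λ` by
`integral_torusHaar_eq_smul_setIntegral_Icc` (`∫ F dHaar = (2π)^{-|Λ|} ∫_{[0,2π]^Λ} F(e^{iθ}) dθ`)
and specialised to the directed bonds `(z, i) : TorusSite 3 L × Fin 3` of `(ℤ/Lℤ)³`; `cube L` is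
that cube by definition.
-/

noncomputable section

namespace Summit.HubbardSuperconductivity.HubbardSuperconductivity.Theorems.PerturbedXYOrder

open MeasureTheory Literature.Probability.LatticeModels
open Summit.HubbardSuperconductivity.HubbardSuperconductivity.Theses.NodalWardXY


/-- **Griffiths' first inequality for the torus rotator**: every two-point function
`∫ cos(θ_x − θ_y) e^{J Σ_b cos ∇_b θ} dθ` on `[0,2π]^Λ` is non-negative for `J ≥ 0` (Ginibre 1970). [cite: Ginibre1970, main theorem with the plane-rotator example] -/
theorem stub_twoPointNonneg :
    ∀ (J : ℝ), 0 ≤ J → ∀ (L : ℕ) [NeZero L] (x y : TorusSite 3 L),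
      0 ≤ ∫ θ in cube L, Real.cos (θ x - θ y) * Real.exp (J * ∑ b : Bond L, Real.cos (θ (b.1 + Pi.single b.2 1) - θ b.1)) :=
  fun _J hJ L _ x y => setIntegral_torus_cos_mul_exp_nonneg L hJ x y

end Summit.HubbardSuperconductivity.HubbardSuperconductivity.Theorems.PerturbedXYOrder

end
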